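import Summits.Ventures.CertifiedManyBodySolver.Downfold.EmeryBoxesLSCO
import Summits.Ventures.CertifiedManyBodySolver.Downfold.EmeryBoxesLa214V122
import Summits.Ventures.CertifiedManyBodySolver.Downfold.EmeryFillingRepoint
import HarnessLib

/-!
# The LSCO x = 1/8 3BE box after box #18 §OF-RECORD v1.18 / v1.22: `emeryBoxLa214M15v122` = the re-issued La₂CuO₄ companion `emeryBoxLa214v122` RE-POINTED
# to the M15 hole count — one definition on the re-pointing kernel, plus the generic lemma «`Refines` survives a common re-pointing»

Venture CertifiedManyBodySolver, cell `pub/hubbard-downfold` (S1 = ROUTER), seat hubbard-downfold-mod-4 (S1/S2 Emery seam); namespace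
`Summit.Ventures.CertifiedManyBodySolver.Downfold`. `emeryBoxLa214M15` (`EmeryBoxesLSCO`, S2's anchor-box twin at x = 1/8) carries the La-214 companion entries
of `EmeryBoxesCuprates` with `nHoles` [1.105, 1.145]; those interaction entries were re-issued BY SOURCE in `EmeryBoxesLa214V122` (box #18 §OF-RECORD v1.18:
U_pp [3.4, 6.13], V_pd [0.57, 2.68]; v1.22: U_dd [4.83, 10.5]; `emeryBoxLa214v122`, old ⊑ new). THIS FILE closes the same lag for the x = 1/8 column WITHOUT a
second copy of the entries: `emeryBoxLa214M15v122 := Function.update emeryBoxLa214v122 .nHoles (some la214M15Emery_nH)`, the identity `emeryBoxLa214M15 =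
Function.update emeryBoxLa214 .nHoles (some la214M15Emery_nH)` (by cases), the generic lemma `Box.Refines.update_same` (if `B ⊑ C` then re-pointing the SAME
coordinate to the SAME entry on both sides preserves `⊑`; proof through `Entry.fst_mem` as in `EmeryFillingRepoint`), hence **`emeryBoxLa214M15_refines_v122`**
(old ⊑ new, downward transfer of every word typed on the re-issued column box), the entries / corners / `_energyWord` / `_energyFloor` doors of the re-issued
column box (the seam-shape doors come from `emeryBoxLa214v122`'s through `holdsOn_update_nHoles_iff` — the filling is not a seam coordinate), and its filling
enclosure ρ ∈ [971/800, 979/800] = [1.21375, 1.22375]. Everything PROVED (0 sorry); SCREENING-GRADE inputs; nothing about the material is certified; the M15 U-SLICES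
(`EmeryBoxesLa214M15Slices`, pinned pairs) are unchanged by the re-issue.
-/

namespace Summit.Ventures.CertifiedManyBodySolver.Downfold

open NonemptyInterval Literature.MathematicalPhysics.QuantumLattice

/-! ### Generic: `Refines` survives a common re-pointing -/

/-- **If `B ⊑ C`, then `update B c x ⊑ update C c x`** for any common new entry (or erasure) `x` at the same coordinate. [folklore] -/
theorem Box.Refines.update_same {ι : Type*} [DecidableEq ι] {B C : Box ι} (h : B.Refines C) (c : ι) (x : Option Entry) :
    Box.Refines (Function.update B c x) (Function.update C c x) := by
  intro p hp i f hi
  by_cases hic : i = c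
  · subst hic
    rw [Function.update_self] at hi
    exact hp i f (by rw [Function.update_self]; exact hi)
  · -- move `p` back into `B`'s old `c` entry, push through `h`, read coordinate `i ≠ c`
    rw [Function.update_of_ne hic] at hi
    have key : ∀ v : ℝ, (∀ g, B c = some g → g.Mem v) → f.Mem (p i) := fun v hv => by
      have hq : B.Mem (Function.update p c v) := Box.mem_of_mem_update hp hv
      have hC := h _ hq i f hi
      rwa [Function.update_of_ne hic] at hC
    cases hB : B c with
    | none => exact key 0 (fun g hg => by rw [hB] at hg; cases hg)
    | some g₀ => exact key ((g₀.encl.fst : ℚ) : ℝ) (fun g hg => by rw [hB, Option.some.injEq] at hg; subst hg; exact Entry.fst_mem _)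

/-! ### The x = 1/8 column box on the re-issued rows -/

/-- `emeryBoxLa214M15` IS the La-214 companion re-pointed to the M15 hole count (by cases on the coordinate). [folklore] -/
theorem emeryBoxLa214M15_eq_update : emeryBoxLa214M15 = Function.update emeryBoxLa214 .nHoles (some la214M15Emery_nH) := by
  funext c; cases c <;> rfl

/-- **`emeryBoxLa214M15v122`**: La₂₋ₓSrₓCuO₄ x = 1/8 (column M15) 3BE box on the §OF-RECORD v1.18 / v1.22 interaction rows = the re-issued companion
`emeryBoxLa214v122` with `nHoles` := `la214M15Emery_nH` [1.105, 1.145]. [folklore] -/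
noncomputable def emeryBoxLa214M15v122 : EmeryBox := Function.update emeryBoxLa214v122 .nHoles (some la214M15Emery_nH)

/-- **Old ⊑ new for the x = 1/8 column** (from `emeryBoxLa214_refines_v122` by the common re-pointing): every word typed on `emeryBoxLa214M15v122` holds on
`emeryBoxLa214M15`. [folklore] -/
theorem emeryBoxLa214M15_refines_v122 : emeryBoxLa214M15.Refines emeryBoxLa214M15v122 := by
  rw [emeryBoxLa214M15_eq_update]
  exact emeryBoxLa214_refines_v122.update_same _ _

/-- Downward transfer v1.22 → old, column M15. [folklore] -/
theorem holdsOn_emeryBoxLa214M15_of_v122 {W : (EmeryCoord → ℝ) → Prop} (h : HoldsOn W emeryBoxLa214M15v122) : HoldsOn W emeryBoxLa214M15 :=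
  h.of_refines emeryBoxLa214M15_refines_v122

/-- The re-issued column box reads back the companion's seam entries and the M15 filling. [folklore] -/
theorem emeryBoxLa214M15v122_entries :
    emeryBoxLa214M15v122 .tpd = some la214Emery_tpd ∧ emeryBoxLa214M15v122 .tpp = some la214Emery_tpp ∧ emeryBoxLa214M15v122 .DeltaPd = some la214Emery_Delta ∧
      emeryBoxLa214M15v122 .Udd = some la214Emery_Udd_v122 ∧ emeryBoxLa214M15v122 .Upp = some la214Emery_Upp_v118 ∧ emeryBoxLa214M15v122 .nHoles = some la214M15Emery_nH := by
  refine ⟨?_, ?_, ?_, ?_, ?_, ?_⟩ <;> simp [emeryBoxLa214M15v122, emeryBoxLa214v122, Function.update]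

/-- **Every seam-shape word holds on the re-issued x = 1/8 box iff it holds on the re-issued x = 0 companion** (they differ in `nHoles` only; kernel
`holdsOn_update_nHoles_iff`) — in particular `emeryBoxLa214v122_energyWord` / `_energyFloor` serve both columns. [folklore] -/
theorem emeryBoxLa214M15v122_seam_iff (εp : ℝ) (W : (Fin 6 → ℝ) → Prop) :
    HoldsOn (fun p : EmeryCoord → ℝ => W (emeryLineCoords εp p)) emeryBoxLa214M15v122 ↔
      HoldsOn (fun p : EmeryCoord → ℝ => W (emeryLineCoords εp p)) emeryBoxLa214v122 :=
  holdsOn_update_nHoles_iff emeryBoxLa214v122 (some la214M15Emery_nH) εp W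

/-- **Vertex-certified three-band energy floor on the re-issued x = 1/8 box** (the x = 0 companion's 64-vertex door, transferred). [cite: Israel1979, Thm. I.3.4] -/
theorem emeryBoxLa214M15v122_energyFloor (s : Fin 4 → ℝ) (ρ : ℝ) {m : ℝ}
    (hm : ∀ w ∈ Fintype.piFinset (fun i => ({(![129/100, 23/50, 17/10, 0, 483/100, 17/5] : Fin 6 → ℝ) i, (![38/25, 33/50, 4, 0, 21/2, 613/100] : Fin 6 → ℝ) i} : Finset ℝ)),
      m ≤ emeryEnergyDensity (emeryLine s w) ρ) :
    HoldsOn (fun p : EmeryCoord → ℝ => m ≤ emeryEnergyDensity (emeryLine s (emeryLineCoords 0 p)) ρ) emeryBoxLa214M15v122 :=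
  (emeryBoxLa214M15v122_seam_iff 0 (fun q => m ≤ emeryEnergyDensity (emeryLine s q) ρ)).2 (emeryBoxLa214v122_energyFloor s ρ hm)

/-- The cell filling on the re-issued x = 1/8 box: ρ ∈ [(6 − 229/200)/4, (6 − 221/200)/4] = [971/800, 979/800]. [cite: ArakiMoriya2003, §4.1 Def. 4.5] -/
theorem emeryBoxLa214M15v122_cellFilling {p : EmeryCoord → ℝ} (hp : emeryBoxLa214M15v122.Mem p) :
    emeryCellFilling p ∈ Set.Icc (((971/800 : ℚ)) : ℝ) (((979/800 : ℚ)) : ℝ) := by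
  have h := emeryCellFilling_mem_Icc_update_nHoles emeryBoxLa214v122 la214M15Emery_nH hp
  rw [la214M15Emery_nH, Entry.encl_ofEnds_fst, Entry.encl_ofEnds_snd] at h
  norm_num at h ⊢
  exact h

end Summit.Ventures.CertifiedManyBodySolver.Downfold
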